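import Literature.AlgebraicGeometry.Motives.CorrespondencesKunneth
import Mathlib.LinearAlgebra.Trace
import HarnessLib

/-!
# The Lefschetz trace formula for an abstract Weil cohomology theory

For a Weil cohomology theory `W : WeilCohomology k K` (`char K = 0`) and a smooth projective `X`
of dimension `n`, this file proves the ingredients of Kleiman's Lefschetz trace formula
(*Algebraic cycles and the Weil conjectures* (1968), Prop. 1.3.6; B. Kahn, *Zeta and L-functions
of varieties and motives* (2020), §3.5) in the axiomatic setting of
`Literature.AlgebraicGeometry.Motives.WeilCohomology`, and draws the consequence used in the proof
that conjecture `B(X)` is independent of the polarisation (Kleiman 1968 §2): **the trace of an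
endomorphism of `Hⁱ(X)` induced by an algebraic correspondence is a rational number**.

* `exists_int_trace_of_mem_algebraicLattice`, `exists_rat_trace_of_mem_ratAlgebraicClasses`: the
  trace of a top-degree (rational) algebraic class is an integer (a rational number) — the
  classes of closed points have trace their degree (axiom `trace_cycleClass`).
* `ofDualRight`: Poincaré duality as an isomorphism `Hⁱ(X)ᵛ ≅ H²ⁿ⁻ⁱ(X)`; for a basis `b` of
  `Hⁱ(X)` the dual classes `bˢ` with `tr (x ∪ bˢ) = xₛ`, and the class
  `D_b = ∑ₛ pr₁* bₛ ∪ pr₂* bˢ ∈ H²ⁿ(X × X)` (`kunnethDiagonalComponent`).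
* `trace_cup_kunnethDiagonalComponent`: if `u ∈ H²ⁿ(X × X)` induces `G : Hⁱ(X) → Hⁱ(X)` then
  `tr_{X×X} (u ∪ D_b) = Tr (G)`.
* `kunnethDiagonal`, `eq_kunnethDiagonal_of_isInducedBy_id`: the **Künneth decomposition of the
  diagonal**, `[Δ] = ∑ₐ (-1)ᵃ D_{bₐ}` for any class `[Δ]` inducing the identity of `H•(X)`
  (such a rational algebraic class exists by the axiom `exists_isInducedBy_id`).
* `exists_rat_trace_of_isAlgebraicOperator`: for `g : Hⁱ(X) → Hⁱ(X)` algebraic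
  (`W.IsAlgebraicOperator n n g`), `Tr (g) = (-1)ⁱ tr_{X×X} (u_g ∪ [Δ]) ∈ ℚ`.

Everything is a theorem with a real proof from the fields of `WeilCohomology` (and the discharged
fact `IsSmoothProjective.tensor_holds`); the two auxiliary definitions are explicit.

## References

* S. Kleiman, *Algebraic cycles and the Weil conjectures*, Dix exposés sur la cohomologie des
  schémas (1968), §1.2 (A)–(C), Prop. 1.3.6 (Lefschetz trace formula), §2.
* B. Kahn, *Zeta and L-functions of varieties and motives* (2020), §3.5 (trace formula in a Weil
  cohomology).
-/

universe u v

open CategoryTheory AlgebraicGeometry MonoidalCategory CartesianMonoidalCategory Opposite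
open scoped TensorProduct

noncomputable section

namespace Literature.AlgebraicGeometry.Motives

namespace WeilCohomology

variable {k : Type u} [Field k] {K : Type v} [Field K] [CharZero K] (W : WeilCohomology k K)
variable {n : ℕ} {X : SchemeOver k}

/-! ## Traces of algebraic classes are rational -/

section RationalTraces

/-- The trace of a top-degree algebraic class `x ∈ Aⁿ(X) ⊆ H²ⁿ(X)` (`X` smooth projective of
dimension `n`) is an integer: `Aⁿ(X)` is generated by classes of closed points `z`, whose trace is
the degree `[κ(z) : k]` (Kleiman 1968 §1.2 (C)). [cite: Kleiman1968AlgebraicCycles, §1.2 (C)] -/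
theorem exists_int_trace_of_mem_algebraicLattice (hX : IsSmoothProjective n X)
    {x : W.obj X (2 * n)} (hx : x ∈ W.algebraicLattice X n) : ∃ m : ℤ, W.trace X n x = m := by
  refine AddSubgroup.closure_induction (fun y hy ↦ ?_) ⟨0, by simp⟩
    (fun y y' _ _ ⟨a, ha⟩ ⟨b, hb⟩ ↦ ⟨a + b, by simp [ha, hb]⟩)
    (fun y _ ⟨a, ha⟩ ↦ ⟨-a, by simp [ha]⟩) hx
  obtain ⟨⟨z, hz⟩, rfl⟩ := hy
  exact ⟨X.hom.residueDegree z, by rw [W.trace_cycleClass hX z hz]; simp⟩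

/-- The trace of a top-degree rational algebraic class `x ∈ Aⁿ(X)_ℚ ⊆ H²ⁿ(X)` is a rational
number. [cite: Kleiman1968AlgebraicCycles, §1.2 (C)] -/
theorem exists_rat_trace_of_mem_ratAlgebraicClasses (hX : IsSmoothProjective n X)
    {x : W.obj X (2 * n)} (hx : x ∈ W.ratAlgebraicClasses X n) : ∃ q : ℚ, W.trace X n x = q := by
  obtain ⟨N, hN, hNx⟩ := hx
  obtain ⟨m, hm⟩ := W.exists_int_trace_of_mem_algebraicLattice hX hNx
  have hNK : (N : K) ≠ 0 := Int.cast_ne_zero.mpr hN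
  refine ⟨m / N, ?_⟩
  rw [map_zsmul, zsmul_eq_mul] at hm
  push_cast
  field_simp
  linear_combination hm

end RationalTraces

/-! ## Poincaré dual bases and the Künneth components of the diagonal -/

section DualBases

/-- Poincaré duality, extensionality on the left: a class `x ∈ Hⁱ(X)` is determined by the
pairings `tr (x ∪ y)`, `y ∈ H²ⁿ⁻ⁱ(X)` (Kleiman 1968 §1.2 (A)). [cite: Kleiman1968AlgebraicCycles, §1.2 (A)] -/
theorem ext_cupPairing_left (hX : IsSmoothProjective n X) {i j : ℕ} (h : i + j = 2 * n)
    {x x' : W.obj X i}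
    (hxy : ∀ y : W.obj X j, W.cupPairing X n i j h x y = W.cupPairing X n i j h x' y) : x = x' :=
  (W.isPerfPair_cupPairing hX i j h).bijective_left.1 (LinearMap.ext hxy)

/-- Poincaré duality on the right (Kleiman 1968 §1.2 (A)): the isomorphism `Hⁱ(X)ᵛ ≅ Hʲ(X)`,
`i + j = 2n`, sending a functional `φ` to the class `y_φ` with `tr (x ∪ y_φ) = φ x`. [cite: Kleiman1968AlgebraicCycles, §1.2 (A)] -/
def ofDualRight (hX : IsSmoothProjective n X) {i j : ℕ} (h : i + j = 2 * n) :
    Module.Dual K (W.obj X i) ≃ₗ[K] W.obj X j :=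
  haveI := W.isPerfPair_cupPairing hX i j h
  (W.cupPairing X n i j h).flip.toPerfPair.symm

/-- The defining property of `ofDualRight`: `tr (x ∪ ofDualRight φ) = φ x`. [folklore] -/
@[simp]
theorem cupPairing_ofDualRight (hX : IsSmoothProjective n X) {i j : ℕ} (h : i + j = 2 * n)
    (φ : Module.Dual K (W.obj X i)) (x : W.obj X i) :
    W.cupPairing X n i j h x (W.ofDualRight hX h φ) = φ x := by
  haveI := W.isPerfPair_cupPairing hX i j h
  exact LinearMap.apply_toPerfPair_flip (p := W.cupPairing X n i j h) φ x

variable {ι : Type*} [Fintype ι]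

/-- The **Künneth component of the diagonal attached to a basis**: for a basis `b` of `Hⁱ(X)` and
`i + j = 2n`, the class `D_b = ∑ₛ pr₁* bₛ ∪ pr₂* bˢ ∈ H²ⁿ(X × X)`, where `bˢ ∈ Hʲ(X)` is the
Poincaré-dual basis, `tr (x ∪ bˢ) = xₛ` (Kleiman 1968, proof of 1.3.6; Kahn 2020 §3.5). [cite: Kleiman1968AlgebraicCycles, Prop. 1.3.6 (proof)] -/
def kunnethDiagonalComponent (hX : IsSmoothProjective n X) {i j : ℕ} (h : i + j = 2 * n)
    (b : Module.Basis ι K (W.obj X i)) : W.obj (X ⊗ X) (2 * n) :=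
  ∑ s, W.externalCup X X h (b s) (W.ofDualRight hX h (b.coord s))

/-- The trace of an endomorphism of `Hⁱ(X)` as a sum of Poincaré pairings over a basis and its
dual basis: `Tr (G) = ∑ₛ tr (G bₛ ∪ bˢ)`. [folklore] -/
theorem trace_eq_sum_cupPairing (hX : IsSmoothProjective n X) {i j : ℕ} (h : i + j = 2 * n)
    [DecidableEq ι] (b : Module.Basis ι K (W.obj X i)) (G : W.obj X i →ₗ[K] W.obj X i) :
    LinearMap.trace K _ G = ∑ s, W.cupPairing X n i j h (G (b s)) (W.ofDualRight hX h (b.coord s)) := by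
  rw [LinearMap.trace_eq_matrix_trace K b G, Matrix.trace]
  refine Finset.sum_congr rfl fun s _ ↦ ?_
  rw [Matrix.diag_apply, LinearMap.toMatrix_apply, cupPairing_ofDualRight, Module.Basis.coord_apply]

/-- If `u ∈ H²ⁿ(X × X)` induces `G : Hⁱ(X) → Hⁱ(X)` (Kleiman's pairing form `W.IsInducedBy`), then
`tr_{X×X} (u ∪ (pr₁* x ∪ pr₂* y)) = tr_X (G x ∪ y)` for `x ∈ Hⁱ(X)`, `y ∈ H²ⁿ⁻ⁱ(X)`. [folklore] -/
theorem trace_cup_externalCup_of_isInducedBy (hX : IsSmoothProjective n X) {i j : ℕ}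
    (h : i + j = 2 * n) {u : W.obj (X ⊗ X) (2 * n)} {G : W.obj X i →ₗ[K] W.obj X i}
    {hm : i + 2 * n + j = 2 * (n + n)} (hG : W.IsInducedBy n n u G h hm)
    (H : 2 * n + 2 * n = 2 * (n + n)) (x : W.obj X i) (y : W.obj X j) :
    W.trace (X ⊗ X) (n + n) (W.cup H u (W.externalCup X X h x y)) =
      W.trace X n (W.cup h (G x) y) := by
  have hXX := isSmoothProjective_tensor hX hX
  rw [hG x y, W.cup_comm_of_even hXX rfl (by omega : 2 * n + i = i + 2 * n) (Or.inr ⟨n, by ring⟩)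
    (W.pullback (fst X X) i x) u, W.cup_assoc hXX (by omega : 2 * n + i = i + 2 * n) h hm H,
    externalCup_apply]

/-- **`tr_{X×X} (u ∪ D_b) = Tr (G)`** for `u ∈ H²ⁿ(X × X)` inducing `G : Hⁱ(X) → Hⁱ(X)` and the
Künneth diagonal component `D_b` of a basis `b` of `Hⁱ(X)` (Kleiman 1968, proof of Prop. 1.3.6;
Kahn 2020 §3.5). [cite: Kleiman1968AlgebraicCycles, Prop. 1.3.6 (proof)] -/
theorem trace_cup_kunnethDiagonalComponent (hX : IsSmoothProjective n X) {i j : ℕ}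
    (h : i + j = 2 * n) (b : Module.Basis ι K (W.obj X i)) {u : W.obj (X ⊗ X) (2 * n)}
    {G : W.obj X i →ₗ[K] W.obj X i} {hm : i + 2 * n + j = 2 * (n + n)}
    (hG : W.IsInducedBy n n u G h hm) (H : 2 * n + 2 * n = 2 * (n + n)) :
    W.trace (X ⊗ X) (n + n) (W.cup H u (W.kunnethDiagonalComponent hX h b)) =
      LinearMap.trace K _ G := by
  classical
  rw [kunnethDiagonalComponent, map_sum, map_sum, W.trace_eq_sum_cupPairing hX h b G]
  exact Finset.sum_congr rfl fun s _ ↦ by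
    rw [W.trace_cup_externalCup_of_isInducedBy hX h hG H, cupPairing_apply]

/-- Expansion of a Poincaré pairing along a basis: `∑ₛ yₛ · tr (bₛ ∪ x) = tr (y ∪ x)`. [folklore] -/
theorem sum_repr_mul_cupPairing {i j : ℕ} (h : j + i = 2 * n) (b : Module.Basis ι K (W.obj X j))
    (y : W.obj X j) (x : W.obj X i) :
    ∑ s, b.repr y s * W.cupPairing X n j i h (b s) x = W.cupPairing X n j i h y x := by
  conv_rhs => rw [← b.sum_repr y]
  rw [map_sum, LinearMap.sum_apply]
  refine Finset.sum_congr rfl fun s _ ↦ ?_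
  rw [map_smul, LinearMap.smul_apply, smul_eq_mul]

/-- The pairing of the Künneth diagonal component `D_b` (`b` a basis of `Hⁱ(X)`, dual classes in
`Hʲ(X)`, `i + j = 2n`) with an external product `pr₁* x ∪ pr₂* y`, `x ∈ Hᵃ(X)`, `y ∈ H²ⁿ⁻ᵃ(X)`:
it is `(-1)ʲ tr_X (x ∪ y)` if `a = j` and `0` otherwise (Koszul sign from moving `pr₂* bˢ` past
`pr₁* x`). [cite: Kleiman1968AlgebraicCycles, Prop. 1.3.6 (proof)] -/
theorem trace_kunnethDiagonalComponent_cup_externalCup (hX : IsSmoothProjective n X) {i j : ℕ}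
    (h : i + j = 2 * n) (b : Module.Basis ι K (W.obj X i)) (H : 2 * n + 2 * n = 2 * (n + n))
    {a a' : ℕ} (ha : a + a' = 2 * n) (x : W.obj X a) (y : W.obj X a') :
    W.trace (X ⊗ X) (n + n)
        (W.cup H (W.kunnethDiagonalComponent hX h b) (W.externalCup X X ha x y)) =
      if j = a then ((j : ℤ).negOnePow : ℤ) • W.trace X n (W.cup ha x y) else 0 := by
  classical
  simp only [kunnethDiagonalComponent, map_sum, LinearMap.sum_apply]
  split_ifs with hja
  · subst hja
    obtain rfl : i = a' := by omega
    have hij : i + j = 2 * n := by omega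
    simp_rw [W.cup_externalCup_externalCup hX hX h ha H hij (by omega : j + i = 2 * n) H,
      LinearMap.map_smul_of_tower, W.trace_externalCup hX hX, Int.negOnePow_mul_self]
    rw [W.trace_cup_comm hX ha hij x y]
    simp_rw [W.trace_cup_comm hX (show j + i = 2 * n by omega) hij _ y, ← cupPairing_apply,
      cupPairing_ofDualRight, Module.Basis.coord_apply, zsmul_eq_mul]
    rw [← W.sum_repr_mul_cupPairing hij b y x, Finset.mul_sum, Finset.mul_sum]
    refine Finset.sum_congr rfl fun s _ ↦ ?_
    ring
  · refine Finset.sum_eq_zero fun s _ ↦ ?_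
    rw [W.cup_externalCup_externalCup hX hX h ha H rfl rfl (by omega), LinearMap.map_smul_of_tower,
      W.trace_externalCup_eq_zero hX hX _ (by omega), smul_zero]

end DualBases

/-! ## The Künneth decomposition of the diagonal and rationality of traces -/

section Diagonal

/-- The **Künneth decomposition of the diagonal** of `X` (smooth projective of dimension `n`):
the class `Δ_W = ∑_{a=0}^{2n} (-1)ᵃ D_{bₐ} ∈ H²ⁿ(X × X)`, where `bₐ` is a basis of `Hᵃ(X)`
(`Module.finBasis`) and `D_{bₐ} = ∑ₛ pr₁* bₐ,ₛ ∪ pr₂* bₐˢ` with dual classes in `H²ⁿ⁻ᵃ(X)`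
(Kleiman 1968, proof of Prop. 1.3.6; Kahn 2020 §3.5). By `eq_kunnethDiagonal_of_isInducedBy_id`
it is *the* class inducing the identity of `H•(X)`, in particular it is the rational algebraic
class of the axiom `exists_isInducedBy_id`. [cite: Kleiman1968AlgebraicCycles, Prop. 1.3.6 (proof)] -/
def kunnethDiagonal (hX : IsSmoothProjective n X) : W.obj (X ⊗ X) (2 * n) :=
  haveI := W.finite_obj hX
  ∑ a : Fin (2 * n + 1), (((a : ℕ) : ℤ).negOnePow : ℤ) •
    W.kunnethDiagonalComponent hX (i := a) (j := 2 * n - a) (by omega) (Module.finBasis K (W.obj X a))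

/-- The Künneth diagonal pairs with external products like the diagonal:
`tr_{X×X} (Δ_W ∪ (pr₁* x ∪ pr₂* y)) = tr_X (x ∪ y)` (only the component `a = 2n - |x|`
contributes, with sign `(-1)ᵃ (-1)^{2n-a} = 1`). [cite: Kleiman1968AlgebraicCycles, Prop. 1.3.6 (proof)] -/
theorem trace_kunnethDiagonal_cup_externalCup (hX : IsSmoothProjective n X)
    (H : 2 * n + 2 * n = 2 * (n + n)) {a a' : ℕ} (ha : a + a' = 2 * n) (x : W.obj X a)
    (y : W.obj X a') :
    W.trace (X ⊗ X) (n + n) (W.cup H (W.kunnethDiagonal hX) (W.externalCup X X ha x y)) =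
      W.trace X n (W.cup ha x y) := by
  haveI := W.finite_obj hX
  have ha' : a' < 2 * n + 1 := by omega
  rw [kunnethDiagonal, map_sum, LinearMap.sum_apply, map_sum,
    Finset.sum_eq_single (⟨a', ha'⟩ : Fin (2 * n + 1))]
  · rw [LinearMap.map_smul_of_tower, LinearMap.smul_apply, map_zsmul,
      W.trace_kunnethDiagonalComponent_cup_externalCup hX _ _ H ha x y,
      if_pos (by change 2 * n - a' = a; omega), smul_smul, ← Units.val_mul, ← Int.negOnePow_add,
      Int.negOnePow_even _ ⟨n, by change (a' : ℤ) + ((2 * n - a' : ℕ) : ℤ) = n + n; omega⟩,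
      Units.val_one, one_smul]
  · intro c _ hc
    rw [LinearMap.map_smul_of_tower, LinearMap.smul_apply, map_zsmul,
      W.trace_kunnethDiagonalComponent_cup_externalCup hX _ _ H ha x y, if_neg, smul_zero]
    intro h'
    exact hc (Fin.ext (by change (c : ℕ) = a'; omega))
  · intro h
    exact absurd (Finset.mem_univ _) h

/-- **Uniqueness of the class of the diagonal.** A class `u ∈ H²ⁿ(X × X)` inducing the identity of
every `Hᵃ(X)` (as the rational algebraic class of the axiom `exists_isInducedBy_id` does) is the
Künneth diagonal `∑ₐ (-1)ᵃ D_{bₐ}` (Poincaré duality on `X × X` and Künneth induction). [cite: Kleiman1968AlgebraicCycles, Prop. 1.3.6 (proof)] -/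
theorem eq_kunnethDiagonal_of_isInducedBy_id (hX : IsSmoothProjective n X)
    {u : W.obj (X ⊗ X) (2 * n)}
    (hu : ∀ (a a' : ℕ) (ha : a + a' = 2 * n), W.IsInducedBy n n u
      (LinearMap.id : W.obj X a →ₗ[K] W.obj X a) ha (show a + 2 * n + a' = 2 * (n + n) by omega)) :
    u = W.kunnethDiagonal hX := by
  have hXX := isSmoothProjective_tensor hX hX
  have H : 2 * n + 2 * n = 2 * (n + n) := by omega
  refine W.ext_cupPairing_left hXX H fun w ↦ ?_
  simp only [cupPairing_apply]
  induction w using W.kunneth_induction hX hX with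
  | zero => simp
  | add w w' hw hw' => simp only [map_add, hw, hw']
  | ext a a' ha x y =>
    rw [W.trace_cup_externalCup_of_isInducedBy hX ha (hu a a' ha) H x y, LinearMap.id_apply,
      W.trace_kunnethDiagonal_cup_externalCup hX H ha x y]

/-- **Traces of algebraic endomorphisms are rational** (Kleiman 1968 §2, via the Lefschetz trace
formula 1.3.6; Kleiman 1994 §4): for `X` smooth projective of dimension `n` and an endomorphism
`g` of `Hⁱ(X)` induced by an algebraic correspondence with `ℚ`-coefficients
(`W.IsAlgebraicOperator n n g`), `Tr (g) ∈ ℚ`. Proof: with `u_g ∈ Aⁿ(X × X)_ℚ` the class inducing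
`g` (and `0` on the other `Hᵃ(X)`) and `Δ ∈ Aⁿ(X × X)_ℚ` the class of the diagonal
(`exists_isInducedBy_id`), `tr_{X×X} (u_g ∪ Δ) ∈ ℚ` (`cup_mem_ratAlgebraicClasses`,
`exists_rat_trace_of_mem_ratAlgebraicClasses`), while `Δ = ∑ₐ (-1)ᵃ D_{bₐ}`
(`eq_kunnethDiagonal_of_isInducedBy_id`) gives `tr (u_g ∪ Δ) = ∑ₐ (-1)ᵃ Tr (g_a) = (-1)ⁱ Tr (g)`
(`trace_cup_kunnethDiagonalComponent`). [cite: Kleiman1968AlgebraicCycles, Prop. 1.3.6 and §2] -/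
theorem exists_rat_trace_of_isAlgebraicOperator (hX : IsSmoothProjective n X) {i : ℕ}
    {g : W.obj X i →ₗ[K] W.obj X i} (hg : W.IsAlgebraicOperator n n g) :
    ∃ q : ℚ, LinearMap.trace K _ g = q := by
  classical
  by_cases hi : 2 * n < i
  · haveI := W.subsingleton_obj hX hi
    have : g = 0 := Subsingleton.elim _ _
    exact ⟨0, by simp [this]⟩
  haveI := W.finite_obj hX
  have hXX := isSmoothProjective_tensor hX hX
  have H : 2 * n + 2 * n = 2 * (n + n) := by omega
  obtain ⟨u, hu, -⟩ := hg
  obtain ⟨uΔ, huΔ, hid⟩ := W.exists_isInducedBy_id hX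
  have hmem : W.cup H (u n : W.obj (X ⊗ X) (2 * n)) uΔ ∈ W.ratAlgebraicClasses (X ⊗ X) (n + n) :=
    W.cup_mem_ratAlgebraicClasses hXX (p := n) (q := n) rfl _ _ (u n).2 huΔ
  obtain ⟨q, hq⟩ := W.exists_rat_trace_of_mem_ratAlgebraicClasses hXX hmem
  have hΔ : uΔ = W.kunnethDiagonal hX :=
    W.eq_kunnethDiagonal_of_isInducedBy_id hX fun a a' ha ↦ hid a a' ha
  have key : W.trace (X ⊗ X) (n + n) (W.cup H (u n : W.obj (X ⊗ X) (2 * n)) uΔ) =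
      ∑ a : Fin (2 * n + 1), (((a : ℕ) : ℤ).negOnePow : ℤ) •
        LinearMap.trace K _ (PreWeilCohomology.GradedOp.ofLinearMap g a a) := by
    rw [hΔ, kunnethDiagonal, map_sum, map_sum]
    refine Finset.sum_congr rfl fun a _ ↦ ?_
    rw [map_zsmul, map_zsmul]
    congr 1
    exact W.trace_cup_kunnethDiagonalComponent hX _ _
      (hu a a n (2 * n - a) (by omega) (by omega) (by omega)) H
  rw [Finset.sum_eq_single (⟨i, by omega⟩ : Fin (2 * n + 1)), hq] at key
  · change (q : K) = (((i : ℕ) : ℤ).negOnePow : ℤ) •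
      LinearMap.trace K _ (PreWeilCohomology.GradedOp.ofLinearMap g i i) at key
    rw [PreWeilCohomology.GradedOp.ofLinearMap_apply_same] at key
    refine ⟨((i : ℤ).negOnePow : ℤ) * q, ?_⟩
    push_cast
    rw [key, zsmul_eq_mul, ← mul_assoc, ← Int.cast_mul, ← Units.val_mul, Int.units_mul_self,
      Units.val_one, Int.cast_one, one_mul]
  · intro c _ hc
    rw [PreWeilCohomology.GradedOp.ofLinearMap_apply_of_ne _ (fun h ↦ hc (Fin.ext h.1.symm)),
      map_zero, smul_zero]
  · intro h
    exact absurd (Finset.mem_univ _) h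

end Diagonal

end WeilCohomology

end Literature.AlgebraicGeometry.Motives

end
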